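import Summits.BirchSwinnertonDyer.BirchSwinnertonDyer.Theorems.ManinLocalTwoThreeCubeRootIntegralAwayFromThree
import HarnessLib

/-!
# (INT)_K, generic algebra: cube roots stay in a subring containing `1/3`; the subring `ℤ̄[1/3]`-type predicate
# `∃ k, IsIntegral ℤ (3^k·x)`; Bezout merging of `3`-adic and prime-to-`3` integrality
(route `ManinLocalTwoThree`, crux C3 `ManinPrimeToThreeAtNine` stmt-BirchSwinnertonDyer-22968; cell bsd-f2-manin, prover seat p3 gen 16 —
piece (INT)_K of the `K`-rational UDC line for RES₃♭ (-an g39 `UDCKummerLineK`, p2 g18's split 16:58:48Z), `--supports` 22968)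

* `coeff_mem_of_pow_three_eq` — over any commutative ring `K` and subring `S ∋ s` with `3s = 1`: if `Θ ∈ S⟦X⟧` (coefficientwise),
  `h³ = Θ` and `h(0) = −1` then `h ∈ S⟦X⟧` (the strong induction of `isPadicInt_of_pow_three_eq`, p3 g15, with `ℤ_p` replaced by `S`).
* `exists_subring_iff_isIntegral_pow_mul` — `{x | ∃ k, 3^k·x is integral over ℤ}` is a subring (of any commutative ring).
* `isIntegral_of_mul_of_pow_mul` — Bezout: `M·x` and `3^k·x` integral over `ℤ` with `3 ∤ M` ⟹ `x` integral;
  `isIntegral_pow_mul_of_exists` — the merge used by (INT)_K.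

HONEST FRAMING.  Pure commutative algebra; nothing about C3, Manin's conjecture or BSD is proved here.  No definitions, no sorry. [folklore]
-/

set_option autoImplicit false
-- lint-debt: the directory name repeats the summit name (sibling precedent `ManinLocalTwoThreeCubeRootIntegralAwayFromThree.lean`)
set_option linter.dupNamespace false

noncomputable section

open scoped Classical
open PowerSeries

namespace Summit.BirchSwinnertonDyer.BirchSwinnertonDyer.Theorems.ManinLocalTwoThree.AlgIntCubeRoot

open Summit.BirchSwinnertonDyer.BirchSwinnertonDyer.Theorems.ManinLocalTwoThree.KummerCubeRootBounded (coeff_mul_of_coeff_lt_eq_zero)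

/-! ## §1 Cube roots with constant term `−1` stay in a subring containing `1/3` -/

/-- A power series all of whose coefficients lie in a subring `S` is the image of a series over `S`. [folklore] -/
theorem exists_map_subtype_eq {K : Type*} [CommRing K] (S : Subring K) {t : K⟦X⟧} (ht : ∀ n, coeff n t ∈ S) :
    ∃ t' : S⟦X⟧, PowerSeries.map S.subtype t' = t :=
  ⟨PowerSeries.mk fun n ↦ ⟨coeff n t, ht n⟩, by ext n; simp [coeff_map]⟩

/-- Coefficients of a power of a series with coefficients in `S` lie in `S`. [folklore] -/
theorem coeff_pow_mem {K : Type*} [CommRing K] (S : Subring K) {t : K⟦X⟧} (ht : ∀ n, coeff n t ∈ S) (m n : ℕ) :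
    coeff n (t ^ m) ∈ S := by
  obtain ⟨t', rfl⟩ := exists_map_subtype_eq S ht
  rw [← map_pow, coeff_map]
  exact (coeff n (t' ^ m)).2

/-- **Cube roots with constant term `−1` stay in a subring containing `1/3`.**  If `Θ ∈ S⟦X⟧` (coefficientwise), `h³ = Θ` and
`h(0) = −1` then every coefficient of `h` lies in `S`: in degree `n ≥ 1`, `Θₙ = (t³)ₙ + 3hₙ` with `t` the truncation of `h` below `n`.
[folklore] -/
theorem coeff_mem_of_pow_three_eq {K : Type*} [CommRing K] (S : Subring K) {s : K} (hs : s ∈ S) (h3s : 3 * s = 1)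
    {Θ h : K⟦X⟧} (hΘ : ∀ n, coeff n Θ ∈ S) (hh : h ^ 3 = Θ) (hh0 : constantCoeff h = -1) : ∀ n, coeff n h ∈ S := by
  intro n
  induction n using Nat.strong_induction_on with
  | _ n ih =>
    rcases Nat.eq_zero_or_pos n with rfl | hn
    · rw [coeff_zero_eq_constantCoeff, hh0]; exact S.neg_mem S.one_mem
    -- truncation `t` below `n` and remainder `r`
    set t : K⟦X⟧ := PowerSeries.mk fun m ↦ if m < n then coeff m h else 0 with ht
    set r : K⟦X⟧ := h - t with hrdef
    have hr : ∀ i < n, coeff i r = 0 := fun i hi ↦ by simp [hrdef, ht, coeff_mk, hi]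
    have hrn : coeff n r = coeff n h := by simp [hrdef, ht, coeff_mk]
    have ht0 : constantCoeff t = constantCoeff h := by
      rw [← coeff_zero_eq_constantCoeff, ht, coeff_mk, if_pos hn, coeff_zero_eq_constantCoeff]
    have htS : ∀ m, coeff m t ∈ S := fun m ↦ by
      rw [ht, coeff_mk]
      split_ifs with hm
      · exact ih m hm
      · exact S.zero_mem
    -- degree-`n` coefficients of the pieces
    have hr2 : ∀ m ≤ n, coeff m (r * r) = 0 := fun m hm ↦ by
      rw [coeff_mul_of_coeff_lt_eq_zero hr hm, ← coeff_zero_eq_constantCoeff, hr 0 hn, zero_mul]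
    have hr3 : coeff n (r * r * r) = 0 := by
      rw [coeff_mul_of_coeff_lt_eq_zero hr le_rfl, ← coeff_zero_eq_constantCoeff, hr2 0 (Nat.zero_le _), zero_mul]
    have htr2 : coeff n (t * (r * r)) = 0 := by
      rw [coeff_mul_of_coeff_lt_eq_zero (fun i hi ↦ hr2 i hi.le) le_rfl, hr2 n le_rfl, mul_zero]
    have ht2r : coeff n (t * t * r) = coeff n h := by
      rw [coeff_mul_of_coeff_lt_eq_zero hr le_rfl, map_mul, ht0, hrn, hh0]; ring
    have hexp : coeff n Θ = coeff n (t ^ 3) + 3 * coeff n h := by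
      have e : Θ = t ^ 3 + 3 * (t * t * r) + 3 * (t * (r * r)) + r * r * r := by
        rw [← hh, show h = t + r by rw [hrdef]; ring]; ring
      rw [e, map_add, map_add, map_add, hr3, add_zero, show (3 : K⟦X⟧) = C (3 : K) from (map_ofNat C 3).symm, coeff_C_mul,
        coeff_C_mul, htr2, mul_zero, add_zero, ht2r]
    -- solve for `hₙ = s·(Θₙ − (t³)ₙ)`
    have hsolve : coeff n h = s * (coeff n Θ - coeff n (t ^ 3)) := by
      rw [hexp]; linear_combination (-(coeff n h)) * h3s
    rw [hsolve]
    exact S.mul_mem hs (S.sub_mem (hΘ n) (coeff_pow_mem S htS 3 n))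

/-! ## §2 The predicate `∃ k, IsIntegral ℤ (3^k·x)` -/

section ThreeLocal

variable {K : Type*} [CommRing K]

/-- `3^k` (as an element of `K`) is integral over `ℤ`. [folklore] -/
theorem isIntegral_three_pow (k : ℕ) : IsIntegral ℤ ((3 : K) ^ k) := by
  have : ((3 ^ k : ℤ) : K) = (3 : K) ^ k := by push_cast; rfl
  rw [← this]; exact isIntegral_algebraMap (R := ℤ) (x := (3 ^ k : ℤ))

/-- Monotonicity: `3^k x` integral ⟹ `3^{k'} x` integral for `k ≤ k'`. [folklore] -/
theorem isIntegral_pow_mul_mono {x : K} {k k' : ℕ} (hkk' : k ≤ k') (h : IsIntegral ℤ ((3 : K) ^ k * x)) :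
    IsIntegral ℤ ((3 : K) ^ k' * x) := by
  obtain ⟨d, rfl⟩ := Nat.exists_eq_add_of_le hkk'
  rw [pow_add, mul_comm ((3 : K) ^ k), mul_assoc]
  exact (isIntegral_three_pow d).mul h

/-- **`{x | ∃ k, 3^k·x integral over ℤ}` is a subring.** [folklore] -/
theorem exists_subring_iff_isIntegral_pow_mul (K : Type*) [CommRing K] :
    ∃ S : Subring K, ∀ x, x ∈ S ↔ ∃ k : ℕ, IsIntegral ℤ ((3 : K) ^ k * x) := by
  refine ⟨{ carrier := {x | ∃ k : ℕ, IsIntegral ℤ ((3 : K) ^ k * x)}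
            mul_mem' := ?_, one_mem' := ⟨0, by simpa using isIntegral_one⟩,
            add_mem' := ?_, zero_mem' := ⟨0, by simpa using isIntegral_zero⟩, neg_mem' := ?_ }, fun x ↦ Iff.rfl⟩
  · rintro x y ⟨k, hk⟩ ⟨l, hl⟩
    exact ⟨k + l, by rw [show (3 : K) ^ (k + l) * (x * y) = 3 ^ k * x * (3 ^ l * y) by ring]; exact hk.mul hl⟩
  · rintro x y ⟨k, hk⟩ ⟨l, hl⟩
    refine ⟨k + l, ?_⟩
    rw [show (3 : K) ^ (k + l) * (x + y) = 3 ^ l * (3 ^ k * x) + 3 ^ k * (3 ^ l * y) by ring]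
    exact ((isIntegral_three_pow l).mul hk).add ((isIntegral_three_pow k).mul hl)
  · rintro x ⟨k, hk⟩
    exact ⟨k, by rw [mul_neg]; exact hk.neg⟩

/-- An element integral over `ℤ` satisfies the predicate (`k = 0`). [folklore] -/
theorem exists_isIntegral_pow_mul_of_isIntegral {x : K} (hx : IsIntegral ℤ x) : ∃ k : ℕ, IsIntegral ℤ ((3 : K) ^ k * x) :=
  ⟨0, by simpa using hx⟩

/-- `1/3`-type elements: if `3·x` is integral then `x` satisfies the predicate. [folklore] -/
theorem exists_isIntegral_pow_mul_of_three_mul {x : K} (hx : IsIntegral ℤ (3 * x)) : ∃ k : ℕ, IsIntegral ℤ ((3 : K) ^ k * x) :=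
  ⟨1, by simpa using hx⟩

/-! ## §3 Bezout merging -/

/-- **Bezout**: if `M·x` and `3^k·x` are integral over `ℤ` and `3 ∤ M` then `x` is integral (`1 = aM + b3^k`). [folklore] -/
theorem isIntegral_of_mul_of_pow_mul {x : K} {M k : ℕ} (hM3 : ¬ 3 ∣ M) (hM : IsIntegral ℤ ((M : K) * x))
    (hk : IsIntegral ℤ ((3 : K) ^ k * x)) : IsIntegral ℤ x := by
  have hcop : IsCoprime (M : ℤ) ((3 : ℤ) ^ k) := by
    rw [Int.isCoprime_iff_gcd_eq_one]
    have h1 : Nat.Coprime M (3 ^ k) := Nat.Coprime.pow_right k ((Nat.Prime.coprime_iff_not_dvd Nat.prime_three).mpr hM3).symm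
    exact_mod_cast h1
  obtain ⟨a, b, hab⟩ := hcop
  have hx : x = (a : K) * ((M : K) * x) + (b : K) * ((3 : K) ^ k * x) := by
    have e : ((a * M + b * 3 ^ k : ℤ) : K) = 1 := by rw [hab, Int.cast_one]
    push_cast at e
    linear_combination (-x) * e
  rw [hx]
  exact ((isIntegral_algebraMap (R := ℤ) (x := a)).mul hM).add ((isIntegral_algebraMap (R := ℤ) (x := b)).mul hk)

/-- **The merge**: `3^k·x` integral for SOME `k`, and `M·3^{K'}·x` integral with `3 ∤ M` ⟹ `3^{K'}·x` integral. [folklore] -/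
theorem isIntegral_pow_mul_of_exists {x : K} {M K' : ℕ} (hM3 : ¬ 3 ∣ M) (hM : IsIntegral ℤ ((M : K) * 3 ^ K' * x))
    (hx : ∃ k : ℕ, IsIntegral ℤ ((3 : K) ^ k * x)) : IsIntegral ℤ ((3 : K) ^ K' * x) := by
  obtain ⟨k, hk⟩ := hx
  refine isIntegral_of_mul_of_pow_mul (k := k) hM3 (by rw [← mul_assoc]; exact hM) ?_
  rw [← mul_assoc, ← pow_add]
  exact isIntegral_pow_mul_mono (by omega) hk

end ThreeLocal

end Summit.BirchSwinnertonDyer.BirchSwinnertonDyer.Theorems.ManinLocalTwoThree.AlgIntCubeRoot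

end
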